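import Summits.CriticalPhenomena.PercolationContinuityZ3.Theorems.PercNearOneGluingNoHeavyLowerTailCubicThreePointIncTwin
import Summits.CriticalPhenomena.PercolationContinuityZ3.Theorems.PercNearOneGluingNoHeavyLowerTailCubicThreePointAGPrW
import Summits.CriticalPhenomena.PercolationContinuityZ3.Theorems.PercNearOneGluingNoHeavyLowerTailCubicThreePointSharpDichotomy
import Mathlib.Tactic.Ring
import Mathlib.Tactic.Linarith
import Mathlib.Tactic.Positivity
import HarnessLib

/-!
# `NoHeavyLowerTail` (stmt-CriticalPhenomena-4575) — the twin rows `F` (3PT-LB) and `T_inc` are each closed under PARALLEL (join) and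
# SERIES-type (meet) composition, WITHOUT the regime dichotomy; hence `T_inc ≥ 0` is preserved by gluing graphs along the terminal triple

Support file (prover prim-sahi-p2 gen 2, SAHI cell P2; `--supports stmt-CriticalPhenomena-4575`).  No definitions, no named facts, no sorries; pure real
algebra plus the cell calculus of `…CubicThreePointGluingJoinCells`.

kcluster's K3-semigroup theorem (`maxH_join_nonneg` / `maxH_meet_nonneg`, `…CubicThreePointJoinClosure`) says that the SHARP region
`S₀ = {AG ≥ 0, max(Ha,Hb) ≥ 0}` of three-point laws is closed under the lattice-join composition (parallel gluing of two networks at the terminals `a,b,c`)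
and the meet composition (its `q ↔ t` dual).  Here the same is proved for the two WEAK cubic rows on their own:
* `tincH_join_nonneg` — **`{AG ≥ 0, T_inc ≥ 0}` is join-closed**: if two probability vectors `x = (q,u,t)`, `y = (Q,v,T)` satisfy Gladkov's `AG ≥ 0` and the
  increasing twin row `T_inc = (σ + q)·AG − e₃ ≥ 0` (`= Xi + q·AG`, `σ` = total mass), so does their join `z` (cells `zq = qQ`, `zᵢ = q vᵢ + uᵢ Q + uᵢ vᵢ`, …).
  PROOF: an exact Positivstellensatz-type identity found by LP (kit j081011; 357 products, rational coefficients with denominators ≤ 48, all positive):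
  `T_inc(z) = P₁·T_inc(x) + P₂·T_inc(y) + P₃·AG(x) + P₄·AG(y) + P₅·AG(x)AG(y) + P₆·AG(x)T_inc(y) + P₇·T_inc(x)AG(y) + P₈·T_inc(x)T_inc(y) + P₉` with every `Pᵢ` a
  polynomial with nonnegative coefficients in the ten cells (`key`, checked by `ring`), then `positivity`.
* `F_join_nonneg` — the same for the decreasing row `F = (σ + t)·AG − e₃` (3PT-LB) (kit j081013; 314 products, denominators ≤ 12).
* `tincH_meet_nonneg`, `F_meet_nonneg` — the meet versions, by the `q ↔ t` duality `F(t,u,q) = T_inc(q,u,t)`, `AG(t,u,q) = AG(q,u,t)` (`AG_dual`) and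
  `meet(x,y) = dual(join(dual x, dual y))`, exactly as in `maxH_meet_nonneg`.
* `TerminalGluing.tincW_join_nonneg` — GRAPH LEVEL: for two edge systems `(D₁,K₁)`, `(D₂,K₂)` on disjoint random edge sets meeting only in the terminals
  (hypotheses of `PrW_join_Q/…/T`), if both finitary laws satisfy `T_inc ≥ 0` then so does the law of the union (`AG ≥ 0` is automatic for `PrW` laws:
  `AG_PrW_nonneg`).  With `IncTwin`/`…GluingPendantCells` (pendant = meet with an arm law) and `…GluingBlobEdge`: the class of weighted graphs on which the
  open increasing row `E₃({a↔b}∪{a↔c}, {a↔b}∪{b↔c}, {a↔c}∪{b↔c}) ≥ 0` holds is closed under terminal gluing, pendant two-terminal networks and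
  blob substitution — so a minimal counterexample, if any, is `{a,b,c}`-inseparable (and, by `…IncTwin`, in the dense regime `t > q`).
[cite: Gladkov2024StrongFKG, Cor. 4.2 (AG)]; [cite: LiebSahi2021, eq. (2.1) (the functional E₃)]
-/

namespace Summit.CriticalPhenomena.PercolationContinuityZ3.Theorems

namespace IncTwin

open CubicThreePointTerminal CubicThreePointStep CubicThreePointSharp

set_option maxHeartbeats 4000000 in
set_option maxRecDepth 8000 in
/-- **`{AG ≥ 0, T_inc ≥ 0}` is closed under the join composition** (parallel gluing at the three terminals).  Cells nonnegative; `T_inc` in the homogeneous form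
`Xi + q·AG = (σ + q)·AG − e₃`.  Exact LP certificate (kit j081011), verified by `ring`. [cite: Gladkov2024StrongFKG, Cor. 4.2 (AG)] -/
theorem tincH_join_nonneg {q u₁ u₂ u₃ t Q v₁ v₂ v₃ T zq z₁ z₂ z₃ zt : ℝ}
    (hq : 0 ≤ q) (hu₁ : 0 ≤ u₁) (hu₂ : 0 ≤ u₂) (hu₃ : 0 ≤ u₃) (ht : 0 ≤ t)
    (hQ : 0 ≤ Q) (hv₁ : 0 ≤ v₁) (hv₂ : 0 ≤ v₂) (hv₃ : 0 ≤ v₃) (hT : 0 ≤ T)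
    (hagx : 0 ≤ AG q u₁ u₂ u₃ t) (hagy : 0 ≤ AG Q v₁ v₂ v₃ T)
    (htx : 0 ≤ Xi q u₁ u₂ u₃ t + q * AG q u₁ u₂ u₃ t) (hty : 0 ≤ Xi Q v₁ v₂ v₃ T + Q * AG Q v₁ v₂ v₃ T)
    (hzq : zq = q * Q) (hz₁ : z₁ = q * v₁ + u₁ * Q + u₁ * v₁) (hz₂ : z₂ = q * v₂ + u₂ * Q + u₂ * v₂)
    (hz₃ : z₃ = q * v₃ + u₃ * Q + u₃ * v₃)
    (hzt : zt = t * (Q + v₁ + v₂ + v₃ + T) + T * (q + u₁ + u₂ + u₃) + (u₁ * (v₂ + v₃) + u₂ * (v₁ + v₃) + u₃ * (v₁ + v₂))) :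
    0 ≤ Xi zq z₁ z₂ z₃ zt + zq * AG zq z₁ z₂ z₃ zt := by
  subst hzq hz₁ hz₂ hz₃ hzt
  have key : Xi (q * Q) (q * v₁ + u₁ * Q + u₁ * v₁) (q * v₂ + u₂ * Q + u₂ * v₂) (q * v₃ + u₃ * Q + u₃ * v₃)
        (t * (Q + v₁ + v₂ + v₃ + T) + T * (q + u₁ + u₂ + u₃) + (u₁ * (v₂ + v₃) + u₂ * (v₁ + v₃) + u₃ * (v₁ + v₂))) + (q * Q) * AG (q * Q) (q * v₁ + u₁ * Q + u₁ * v₁) (q * v₂ + u₂ * Q + u₂ * v₂) (q * v₃ + u₃ * Q + u₃ * v₃)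
        (t * (Q + v₁ + v₂ + v₃ + T) + T * (q + u₁ + u₂ + u₃) + (u₁ * (v₂ + v₃) + u₂ * (v₁ + v₃) + u₃ * (v₁ + v₂))) =
      (q * q * u₁ * Q * v₂ * v₃ + ((3:ℝ)/2) * q * q * u₁ * v₁ * v₂ * v₃ + q * q * u₁ * v₂ * v₂ * v₃ + q * q * u₁ * v₂ * v₃ * v₃
          + q * q * u₁ * v₂ * v₃ * T + q * q * u₂ * Q * v₁ * v₃ + q * q * u₂ * v₁ * v₁ * v₃ + ((3:ℝ)/2) * q * q * u₂ * v₁ * v₂ * v₃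
          + q * q * u₂ * v₁ * v₃ * v₃ + q * q * u₂ * v₁ * v₃ * T + q * q * u₃ * Q * v₁ * v₂ + q * q * u₃ * v₁ * v₁ * v₂
          + q * q * u₃ * v₁ * v₂ * v₂ + ((3:ℝ)/2) * q * q * u₃ * v₁ * v₂ * v₃ + q * q * u₃ * v₁ * v₂ * T + (3:ℝ) * q * q * t * v₁ * v₂ * v₃
          + q * u₁ * u₁ * Q * v₂ * v₃ + ((3:ℝ)/2) * q * u₁ * u₁ * v₁ * v₂ * v₃ + q * u₁ * u₁ * v₂ * v₂ * v₃ + q * u₁ * u₁ * v₂ * v₃ * v₃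
          + q * u₁ * u₁ * v₂ * v₃ * T + q * u₁ * u₂ * Q * Q * v₃ + (3:ℝ) * q * u₁ * u₂ * Q * v₁ * v₃ + (3:ℝ) * q * u₁ * u₂ * Q * v₂ * v₃
          + q * u₁ * u₂ * Q * v₃ * v₃ + ((5:ℝ)/6) * q * u₁ * u₂ * Q * v₃ * T + (2:ℝ) * q * u₁ * u₂ * v₁ * v₁ * v₃ + ((7:ℝ)/3) * q * u₁ * u₂ * v₁ * v₂ * v₃
          + ((13:ℝ)/6) * q * u₁ * u₂ * v₁ * v₃ * v₃ + (2:ℝ) * q * u₁ * u₂ * v₁ * v₃ * T + (2:ℝ) * q * u₁ * u₂ * v₂ * v₂ * v₃ + ((13:ℝ)/6) * q * u₁ * u₂ * v₂ * v₃ * v₃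
          + (2:ℝ) * q * u₁ * u₂ * v₂ * v₃ * T + q * u₁ * u₃ * Q * Q * v₂ + (3:ℝ) * q * u₁ * u₃ * Q * v₁ * v₂ + q * u₁ * u₃ * Q * v₂ * v₂
          + (3:ℝ) * q * u₁ * u₃ * Q * v₂ * v₃ + (3:ℝ) * q * u₁ * u₃ * Q * v₂ * T + (2:ℝ) * q * u₁ * u₃ * v₁ * v₁ * v₂ + (2:ℝ) * q * u₁ * u₃ * v₁ * v₂ * T
          + (2:ℝ) * q * u₁ * u₃ * v₂ * v₃ * v₃ + (2:ℝ) * q * u₁ * u₃ * v₂ * v₃ * T + ((5:ℝ)/2) * q * u₁ * t * Q * v₂ * v₃ + (4:ℝ) * q * u₁ * t * v₁ * v₂ * v₃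
          + ((4:ℝ)/3) * q * u₁ * t * v₂ * v₂ * v₃ + (2:ℝ) * q * u₁ * t * v₂ * v₃ * v₃ + ((5:ℝ)/4) * q * u₁ * t * v₂ * v₃ * T + q * u₂ * u₂ * Q * v₁ * v₃
          + q * u₂ * u₂ * v₁ * v₁ * v₃ + ((3:ℝ)/2) * q * u₂ * u₂ * v₁ * v₂ * v₃ + q * u₂ * u₂ * v₁ * v₃ * v₃ + q * u₂ * u₂ * v₁ * v₃ * T
          + q * u₂ * u₃ * Q * Q * v₁ + q * u₂ * u₃ * Q * v₁ * v₁ + (3:ℝ) * q * u₂ * u₃ * Q * v₁ * v₂ + (3:ℝ) * q * u₂ * u₃ * Q * v₁ * v₃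
          + (3:ℝ) * q * u₂ * u₃ * Q * v₁ * T + (2:ℝ) * q * u₂ * u₃ * v₁ * v₂ * v₂ + (2:ℝ) * q * u₂ * u₃ * v₁ * v₂ * T + (2:ℝ) * q * u₂ * u₃ * v₁ * v₃ * v₃
          + (2:ℝ) * q * u₂ * u₃ * v₁ * v₃ * T + ((13:ℝ)/6) * q * u₂ * t * Q * v₁ * v₃ + (2:ℝ) * q * u₂ * t * v₁ * v₁ * v₃ + (4:ℝ) * q * u₂ * t * v₁ * v₂ * v₃
          + q * u₂ * t * v₁ * v₃ * v₃ + ((3:ℝ)/2) * q * u₂ * t * v₁ * v₃ * T + q * u₃ * u₃ * Q * v₁ * v₂ + q * u₃ * u₃ * v₁ * v₁ * v₂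
          + q * u₃ * u₃ * v₁ * v₂ * v₂ + ((3:ℝ)/2) * q * u₃ * u₃ * v₁ * v₂ * v₃ + q * u₃ * u₃ * v₁ * v₂ * T + ((5:ℝ)/2) * q * u₃ * t * Q * v₁ * v₂
          + ((4:ℝ)/3) * q * u₃ * t * v₁ * v₁ * v₂ + (2:ℝ) * q * u₃ * t * v₁ * v₂ * v₂ + ((10:ℝ)/3) * q * u₃ * t * v₁ * v₂ * v₃ + ((3:ℝ)/2) * q * u₃ * t * v₁ * v₂ * T
          + (2:ℝ) * q * t * t * v₁ * v₂ * v₃ + u₁ * u₁ * u₂ * Q * Q * v₃ + (2:ℝ) * u₁ * u₁ * u₂ * Q * v₁ * v₃ + ((1:ℝ)/2) * u₁ * u₁ * u₂ * Q * v₂ * v₃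
          + u₁ * u₁ * u₂ * Q * v₃ * v₃ + u₁ * u₁ * u₂ * Q * v₃ * T + u₁ * u₁ * u₂ * v₁ * v₁ * v₃ + u₁ * u₁ * u₂ * v₁ * v₃ * v₃
          + u₁ * u₁ * u₂ * v₁ * v₃ * T + ((2:ℝ)/3) * u₁ * u₁ * u₂ * v₂ * v₂ * v₃ + ((3:ℝ)/4) * u₁ * u₁ * u₂ * v₂ * v₃ * T + u₁ * u₁ * u₃ * Q * Q * v₂
          + (2:ℝ) * u₁ * u₁ * u₃ * Q * v₁ * v₂ + u₁ * u₁ * u₃ * Q * v₂ * v₂ + ((1:ℝ)/2) * u₁ * u₁ * u₃ * Q * v₂ * v₃ + u₁ * u₁ * u₃ * Q * v₂ * T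
          + u₁ * u₁ * u₃ * v₁ * v₁ * v₂ + u₁ * u₁ * u₃ * v₁ * v₂ * v₂ + u₁ * u₁ * u₃ * v₁ * v₂ * T + ((2:ℝ)/3) * u₁ * u₁ * u₃ * v₂ * v₂ * v₃
          + ((3:ℝ)/4) * u₁ * u₁ * u₃ * v₂ * v₃ * T + u₁ * u₂ * u₂ * Q * Q * v₃ + ((5:ℝ)/6) * u₁ * u₂ * u₂ * Q * v₁ * v₃ + (2:ℝ) * u₁ * u₂ * u₂ * Q * v₂ * v₃
          + u₁ * u₂ * u₂ * Q * v₃ * v₃ + u₁ * u₂ * u₂ * Q * v₃ * T + u₁ * u₂ * u₂ * v₁ * v₃ * v₃ + ((1:ℝ)/2) * u₁ * u₂ * u₂ * v₁ * v₃ * T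
          + u₁ * u₂ * u₂ * v₂ * v₂ * v₃ + u₁ * u₂ * u₂ * v₂ * v₃ * v₃ + u₁ * u₂ * u₂ * v₂ * v₃ * T + ((3:ℝ)/2) * u₁ * u₂ * u₃ * Q * Q * v₁
          + ((3:ℝ)/2) * u₁ * u₂ * u₃ * Q * Q * v₂ + ((3:ℝ)/2) * u₁ * u₂ * u₃ * Q * Q * v₃ + (4:ℝ) * u₁ * u₂ * u₃ * Q * Q * T + ((3:ℝ)/2) * u₁ * u₂ * u₃ * Q * v₁ * v₁
          + ((1:ℝ)/3) * u₁ * u₂ * u₃ * Q * v₁ * v₃ + ((3:ℝ)/2) * u₁ * u₂ * u₃ * Q * v₂ * v₂ + (3:ℝ) * u₁ * u₂ * u₃ * Q * v₂ * T + ((3:ℝ)/2) * u₁ * u₂ * u₃ * Q * v₃ * v₃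
          + (2:ℝ) * u₁ * u₂ * u₃ * Q * T * T + ((11:ℝ)/3) * u₁ * u₂ * u₃ * v₁ * v₁ * v₂ + (3:ℝ) * u₁ * u₂ * u₃ * v₁ * v₁ * v₃ + (4:ℝ) * u₁ * u₂ * u₃ * v₁ * v₃ * v₃
          + ((2:ℝ)/3) * u₁ * u₂ * u₃ * v₂ * v₂ * v₃ + (3:ℝ) * u₁ * u₂ * u₃ * v₂ * v₃ * v₃ + u₁ * u₂ * t * Q * Q * v₃ + (2:ℝ) * u₁ * u₂ * t * Q * v₁ * v₃
          + (2:ℝ) * u₁ * u₂ * t * Q * v₂ * v₃ + u₁ * u₂ * t * Q * v₃ * v₃ + ((3:ℝ)/2) * u₁ * u₂ * t * Q * v₃ * T + u₁ * u₂ * t * v₁ * v₁ * v₃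
          + ((1:ℝ)/2) * u₁ * u₂ * t * v₁ * v₃ * v₃ + u₁ * u₂ * t * v₁ * v₃ * T + u₁ * u₂ * t * v₂ * v₂ * v₃ + ((1:ℝ)/2) * u₁ * u₂ * t * v₂ * v₃ * v₃
          + u₁ * u₂ * t * v₂ * v₃ * T + u₁ * u₃ * u₃ * Q * Q * v₂ + ((1:ℝ)/2) * u₁ * u₃ * u₃ * Q * v₁ * v₂ + u₁ * u₃ * u₃ * Q * v₂ * v₂
          + (2:ℝ) * u₁ * u₃ * u₃ * Q * v₂ * v₃ + u₁ * u₃ * u₃ * Q * v₂ * T + ((2:ℝ)/3) * u₁ * u₃ * u₃ * v₁ * v₁ * v₂ + ((2:ℝ)/3) * u₁ * u₃ * u₃ * v₁ * v₂ * v₃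
          + ((1:ℝ)/2) * u₁ * u₃ * u₃ * v₁ * v₂ * T + u₁ * u₃ * u₃ * v₂ * v₂ * v₃ + u₁ * u₃ * u₃ * v₂ * v₃ * v₃ + u₁ * u₃ * u₃ * v₂ * v₃ * T
          + u₁ * u₃ * t * Q * Q * v₂ + (2:ℝ) * u₁ * u₃ * t * Q * v₁ * v₂ + u₁ * u₃ * t * Q * v₂ * v₂ + (2:ℝ) * u₁ * u₃ * t * Q * v₂ * v₃
          + ((3:ℝ)/2) * u₁ * u₃ * t * Q * v₂ * T + u₁ * u₃ * t * v₁ * v₁ * v₂ + ((1:ℝ)/2) * u₁ * u₃ * t * v₁ * v₂ * v₂ + u₁ * u₃ * t * v₁ * v₂ * T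
          + ((1:ℝ)/2) * u₁ * u₃ * t * v₂ * v₂ * v₃ + u₁ * u₃ * t * v₂ * v₃ * v₃ + u₁ * u₃ * t * v₂ * v₃ * T + u₂ * u₂ * u₃ * Q * Q * v₁
          + u₂ * u₂ * u₃ * Q * v₁ * v₁ + (2:ℝ) * u₂ * u₂ * u₃ * Q * v₁ * v₂ + ((5:ℝ)/6) * u₂ * u₂ * u₃ * Q * v₁ * v₃ + u₂ * u₂ * u₃ * Q * v₁ * T
          + u₂ * u₂ * u₃ * v₁ * v₁ * v₂ + u₂ * u₂ * u₃ * v₁ * v₂ * v₂ + u₂ * u₂ * u₃ * v₁ * v₂ * T + u₂ * u₂ * u₃ * v₁ * v₃ * v₃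
          + ((1:ℝ)/2) * u₂ * u₂ * u₃ * v₁ * v₃ * T + u₂ * u₃ * u₃ * Q * Q * v₁ + u₂ * u₃ * u₃ * Q * v₁ * v₁ + ((1:ℝ)/2) * u₂ * u₃ * u₃ * Q * v₁ * v₂
          + (2:ℝ) * u₂ * u₃ * u₃ * Q * v₁ * v₃ + ((5:ℝ)/3) * u₂ * u₃ * u₃ * Q * v₁ * T + ((1:ℝ)/3) * u₂ * u₃ * u₃ * v₁ * v₁ * v₃ + ((1:ℝ)/2) * u₂ * u₃ * u₃ * v₁ * v₂ * T
          + u₂ * u₃ * u₃ * v₁ * v₃ * v₃ + u₂ * u₃ * u₃ * v₁ * v₃ * T + u₂ * u₃ * t * Q * Q * v₁ + u₂ * u₃ * t * Q * v₁ * v₁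
          + (2:ℝ) * u₂ * u₃ * t * Q * v₁ * v₂ + (2:ℝ) * u₂ * u₃ * t * Q * v₁ * v₃ + ((3:ℝ)/2) * u₂ * u₃ * t * Q * v₁ * T + ((1:ℝ)/2) * u₂ * u₃ * t * v₁ * v₁ * v₂
          + ((1:ℝ)/2) * u₂ * u₃ * t * v₁ * v₁ * v₃ + u₂ * u₃ * t * v₁ * v₂ * v₂ + u₂ * u₃ * t * v₁ * v₂ * T + u₂ * u₃ * t * v₁ * v₃ * v₃
          + u₂ * u₃ * t * v₁ * v₃ * T)
      + (((1:ℝ)/2) * q * v₂ * v₃ * T + ((1:ℝ)/2) * u₁ * Q * Q * v₁ + ((1:ℝ)/2) * u₁ * Q * Q * v₂ + ((1:ℝ)/2) * u₁ * Q * Q * v₃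
          + ((1:ℝ)/2) * u₁ * Q * v₁ * v₁ + ((3:ℝ)/2) * u₁ * Q * v₁ * v₂ + ((3:ℝ)/2) * u₁ * Q * v₁ * v₃ + ((2:ℝ)/3) * u₁ * Q * v₁ * T
          + ((1:ℝ)/2) * u₁ * Q * v₂ * v₂ + ((2:ℝ)/3) * u₁ * Q * v₂ * T + ((1:ℝ)/2) * u₁ * Q * v₃ * v₃ + ((1:ℝ)/2) * u₁ * Q * T * T
          + ((1:ℝ)/3) * u₁ * v₁ * v₁ * v₂ + ((1:ℝ)/3) * u₁ * v₁ * v₁ * v₃ + ((1:ℝ)/3) * u₁ * v₁ * v₂ * v₂ + u₁ * v₁ * v₃ * v₃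
          + ((1:ℝ)/2) * u₂ * Q * Q * v₁ + ((1:ℝ)/2) * u₂ * Q * Q * v₂ + ((1:ℝ)/2) * u₂ * Q * Q * v₃ + ((1:ℝ)/3) * u₂ * Q * Q * T
          + ((1:ℝ)/2) * u₂ * Q * v₁ * v₁ + ((7:ℝ)/6) * u₂ * Q * v₁ * v₂ + ((1:ℝ)/2) * u₂ * Q * v₂ * v₂ + ((7:ℝ)/6) * u₂ * Q * v₂ * v₃
          + u₂ * Q * v₂ * T + ((1:ℝ)/2) * u₂ * Q * v₃ * v₃ + u₂ * Q * v₃ * T + u₂ * v₁ * v₁ * v₂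
          + ((1:ℝ)/2) * u₂ * v₁ * v₂ * T + ((3:ℝ)/4) * u₂ * v₂ * v₃ * T + ((1:ℝ)/2) * u₃ * Q * Q * v₁ + ((1:ℝ)/2) * u₃ * Q * Q * v₂
          + ((1:ℝ)/2) * u₃ * Q * Q * v₃ + ((1:ℝ)/2) * u₃ * Q * v₁ * v₁ + ((3:ℝ)/2) * u₃ * Q * v₁ * v₃ + ((2:ℝ)/3) * u₃ * Q * v₁ * T
          + ((1:ℝ)/2) * u₃ * Q * v₂ * v₂ + ((3:ℝ)/2) * u₃ * Q * v₂ * v₃ + ((1:ℝ)/2) * u₃ * Q * v₃ * v₃ + u₃ * Q * v₃ * T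
          + ((1:ℝ)/3) * u₃ * v₁ * v₁ * v₃ + u₃ * v₁ * v₂ * v₃ + ((1:ℝ)/2) * u₃ * v₁ * v₃ * T + u₃ * v₂ * v₂ * v₃
          + ((3:ℝ)/4) * u₃ * v₂ * v₃ * T + ((1:ℝ)/2) * t * Q * Q * v₁ + ((1:ℝ)/2) * t * Q * Q * v₂ + ((1:ℝ)/2) * t * Q * Q * v₃
          + ((4:ℝ)/3) * t * Q * Q * T + ((1:ℝ)/2) * t * Q * v₁ * v₁ + ((1:ℝ)/6) * t * Q * v₁ * v₂ + ((1:ℝ)/6) * t * Q * v₁ * v₃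
          + t * Q * v₁ * T + ((1:ℝ)/2) * t * Q * v₂ * v₂ + ((1:ℝ)/6) * t * Q * v₂ * v₃ + t * Q * v₂ * T
          + ((1:ℝ)/2) * t * Q * v₃ * v₃ + ((7:ℝ)/18) * t * Q * T * T + ((1:ℝ)/9) * t * v₁ * v₂ * T + t * v₁ * v₃ * v₃
          + ((1:ℝ)/9) * t * v₁ * v₃ * T + t * v₂ * v₃ * v₃ + ((13:ℝ)/36) * t * v₂ * v₃ * T) * ((AG q u₁ u₂ u₃ t))
      + (((5:ℝ)/3) * u₁ * Q + ((5:ℝ)/3) * u₁ * v₃ + ((1:ℝ)/18) * u₁ * T + ((1:ℝ)/3) * u₃ * Q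
          + (2:ℝ) * t * v₃) * ((AG q u₁ u₂ u₃ t) * (AG Q v₁ v₂ v₃ T))
      + (u₂) * ((AG q u₁ u₂ u₃ t) * (Xi Q v₁ v₂ v₃ T + Q * AG Q v₁ v₂ v₃ T))
      + (((1:ℝ)/2) * q * q * u₁ * v₁ + ((1:ℝ)/2) * q * q * u₁ * v₂ + ((1:ℝ)/2) * q * q * u₁ * v₃ + ((1:ℝ)/2) * q * q * u₁ * T
          + ((1:ℝ)/2) * q * q * u₂ * v₁ + ((1:ℝ)/2) * q * q * u₂ * v₂ + ((1:ℝ)/2) * q * q * u₂ * v₃ + ((1:ℝ)/2) * q * q * u₂ * T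
          + ((1:ℝ)/2) * q * q * u₃ * v₁ + ((1:ℝ)/2) * q * q * u₃ * v₂ + ((1:ℝ)/2) * q * q * u₃ * v₃ + ((1:ℝ)/2) * q * q * u₃ * T
          + ((2:ℝ)/3) * q * q * t * Q + (2:ℝ) * q * q * t * v₃ + ((7:ℝ)/9) * q * q * t * T + ((1:ℝ)/2) * q * u₁ * u₁ * v₁
          + ((1:ℝ)/2) * q * u₁ * u₁ * v₂ + ((1:ℝ)/2) * q * u₁ * u₁ * v₃ + ((1:ℝ)/2) * q * u₁ * u₁ * T + ((11:ℝ)/6) * q * u₁ * u₂ * v₁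
          + ((11:ℝ)/6) * q * u₁ * u₂ * v₂ + ((19:ℝ)/18) * q * u₁ * u₂ * T + ((1:ℝ)/3) * q * u₁ * u₃ * Q + (2:ℝ) * q * u₁ * u₃ * v₁
          + ((11:ℝ)/9) * q * u₁ * u₃ * T + q * u₁ * t * v₁ + q * u₁ * t * v₂ + q * u₁ * t * v₃
          + q * u₁ * t * T + ((1:ℝ)/2) * q * u₂ * u₂ * v₁ + ((1:ℝ)/2) * q * u₂ * u₂ * v₂ + ((1:ℝ)/2) * q * u₂ * u₂ * v₃
          + ((1:ℝ)/2) * q * u₂ * u₂ * T + ((1:ℝ)/3) * q * u₂ * u₃ * Q + (2:ℝ) * q * u₂ * u₃ * v₂ + ((11:ℝ)/9) * q * u₂ * u₃ * T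
          + q * u₂ * t * v₁ + q * u₂ * t * v₃ + ((8:ℝ)/9) * q * u₂ * t * T + ((1:ℝ)/2) * q * u₃ * u₃ * v₁
          + ((1:ℝ)/2) * q * u₃ * u₃ * v₂ + ((1:ℝ)/2) * q * u₃ * u₃ * v₃ + ((1:ℝ)/2) * q * u₃ * u₃ * T + ((1:ℝ)/3) * q * u₃ * t * v₁
          + q * u₃ * t * v₂ + q * u₃ * t * v₃ + ((8:ℝ)/9) * q * u₃ * t * T + ((1:ℝ)/2) * q * t * t * T
          + u₁ * u₂ * u₂ * v₂ + ((1:ℝ)/9) * u₁ * u₂ * u₂ * T + ((13:ℝ)/3) * u₁ * u₂ * u₃ * v₁ + ((5:ℝ)/3) * u₁ * u₂ * u₃ * v₂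
          + ((8:ℝ)/3) * u₁ * u₂ * u₃ * v₃ + ((1:ℝ)/2) * u₁ * u₂ * t * v₁ + ((1:ℝ)/2) * u₁ * u₂ * t * v₂ + ((2:ℝ)/3) * u₁ * u₃ * u₃ * v₁
          + ((1:ℝ)/9) * u₁ * u₃ * u₃ * T + ((1:ℝ)/2) * u₁ * u₃ * t * v₁ + ((1:ℝ)/2) * u₁ * u₃ * t * v₃ + u₂ * u₂ * u₃ * v₂
          + ((1:ℝ)/9) * u₂ * u₂ * u₃ * T + ((1:ℝ)/9) * u₂ * u₃ * u₃ * T + ((1:ℝ)/2) * u₂ * u₃ * t * v₂ + ((1:ℝ)/2) * u₂ * u₃ * t * v₃) * ((AG Q v₁ v₂ v₃ T))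
      + (Q * Q * Q + ((3:ℝ)/2) * Q * Q * v₁ + ((3:ℝ)/2) * Q * Q * v₂ + ((3:ℝ)/2) * Q * Q * v₃
          + ((2:ℝ)/3) * Q * Q * T + ((1:ℝ)/2) * Q * v₁ * v₁ + ((11:ℝ)/6) * Q * v₁ * v₂ + ((11:ℝ)/6) * Q * v₁ * v₃
          + Q * v₁ * T + ((1:ℝ)/2) * Q * v₂ * v₂ + ((11:ℝ)/6) * Q * v₂ * v₃ + Q * v₂ * T
          + ((1:ℝ)/2) * Q * v₃ * v₃ + ((1:ℝ)/9) * Q * T * T + ((7:ℝ)/18) * v₁ * v₂ * T + v₁ * v₃ * v₃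
          + ((7:ℝ)/18) * v₁ * v₃ * T + v₂ * v₃ * v₃ + ((5:ℝ)/36) * v₂ * v₃ * T) * ((Xi q u₁ u₂ u₃ t + q * AG q u₁ u₂ u₃ t))
      + (q * q * q + ((3:ℝ)/2) * q * q * u₁ + ((3:ℝ)/2) * q * q * u₂ + ((3:ℝ)/2) * q * q * u₃
          + q * q * t + ((1:ℝ)/2) * q * u₁ * u₁ + ((7:ℝ)/6) * q * u₁ * u₂ + q * u₁ * u₃
          + ((1:ℝ)/3) * q * u₁ * t + ((1:ℝ)/2) * q * u₂ * u₂ + q * u₂ * u₃ + ((1:ℝ)/2) * q * u₃ * u₃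
          + q * u₃ * t + ((2:ℝ)/3) * u₁ * u₁ * u₂ + ((2:ℝ)/3) * u₁ * u₁ * u₃ + u₁ * u₂ * u₂
          + ((1:ℝ)/2) * u₁ * u₂ * t + ((1:ℝ)/2) * u₁ * u₃ * t + u₂ * u₂ * u₃ + ((1:ℝ)/2) * u₂ * u₃ * t) * ((Xi Q v₁ v₂ v₃ T + Q * AG Q v₁ v₂ v₃ T)) := by
    simp only [Xi, AG]; ring
  rw [key]
  generalize Xi q u₁ u₂ u₃ t + q * AG q u₁ u₂ u₃ t = RX at htx ⊢
  generalize Xi Q v₁ v₂ v₃ T + Q * AG Q v₁ v₂ v₃ T = RY at hty ⊢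
  generalize AG q u₁ u₂ u₃ t = AX at hagx ⊢
  generalize AG Q v₁ v₂ v₃ T = AY at hagy ⊢
  positivity

set_option maxHeartbeats 4000000 in
set_option maxRecDepth 8000 in
/-- **`{AG ≥ 0, F ≥ 0}` is closed under the join composition** (`F = (σ+t)·AG − e₃` = SHK3⁺ = 3PT-LB).  Exact LP certificate (kit j081013), verified by
`ring`. [cite: Gladkov2024StrongFKG, Cor. 4.2 (AG)] -/
theorem F_join_nonneg {q u₁ u₂ u₃ t Q v₁ v₂ v₃ T zq z₁ z₂ z₃ zt : ℝ}
    (hq : 0 ≤ q) (hu₁ : 0 ≤ u₁) (hu₂ : 0 ≤ u₂) (hu₃ : 0 ≤ u₃) (ht : 0 ≤ t)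
    (hQ : 0 ≤ Q) (hv₁ : 0 ≤ v₁) (hv₂ : 0 ≤ v₂) (hv₃ : 0 ≤ v₃) (hT : 0 ≤ T)
    (hagx : 0 ≤ AG q u₁ u₂ u₃ t) (hagy : 0 ≤ AG Q v₁ v₂ v₃ T)
    (hfx : 0 ≤ CubicThreePointStep.F q u₁ u₂ u₃ t) (hfy : 0 ≤ CubicThreePointStep.F Q v₁ v₂ v₃ T)
    (hzq : zq = q * Q) (hz₁ : z₁ = q * v₁ + u₁ * Q + u₁ * v₁) (hz₂ : z₂ = q * v₂ + u₂ * Q + u₂ * v₂)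
    (hz₃ : z₃ = q * v₃ + u₃ * Q + u₃ * v₃)
    (hzt : zt = t * (Q + v₁ + v₂ + v₃ + T) + T * (q + u₁ + u₂ + u₃) + (u₁ * (v₂ + v₃) + u₂ * (v₁ + v₃) + u₃ * (v₁ + v₂))) :
    0 ≤ CubicThreePointStep.F zq z₁ z₂ z₃ zt := by
  subst hzq hz₁ hz₂ hz₃ hzt
  have key : CubicThreePointStep.F (q * Q) (q * v₁ + u₁ * Q + u₁ * v₁) (q * v₂ + u₂ * Q + u₂ * v₂) (q * v₃ + u₃ * Q + u₃ * v₃)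
        (t * (Q + v₁ + v₂ + v₃ + T) + T * (q + u₁ + u₂ + u₃) + (u₁ * (v₂ + v₃) + u₂ * (v₁ + v₃) + u₃ * (v₁ + v₂))) =
      ((2:ℝ) * q * q * u₁ * v₁ * v₂ * v₃ + q * q * u₁ * v₂ * v₂ * v₃ + q * q * u₁ * v₂ * v₃ * v₃ + (2:ℝ) * q * q * u₁ * v₂ * v₃ * T
          + q * q * u₂ * v₁ * v₁ * v₃ + (2:ℝ) * q * q * u₂ * v₁ * v₂ * v₃ + q * q * u₂ * v₁ * v₃ * v₃ + (2:ℝ) * q * q * u₂ * v₁ * v₃ * T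
          + q * q * u₃ * v₁ * v₁ * v₂ + q * q * u₃ * v₁ * v₂ * v₂ + (2:ℝ) * q * q * u₃ * v₁ * v₂ * v₃ + (2:ℝ) * q * q * u₃ * v₁ * v₂ * T
          + (7:ℝ) * q * q * t * v₁ * v₂ * v₃ + q * u₁ * u₁ * Q * v₂ * v₃ + (2:ℝ) * q * u₁ * u₁ * v₁ * v₂ * v₃ + (2:ℝ) * q * u₁ * u₁ * v₂ * v₂ * v₃
          + (2:ℝ) * q * u₁ * u₁ * v₂ * v₃ * v₃ + (2:ℝ) * q * u₁ * u₁ * v₂ * v₃ * T + (2:ℝ) * q * u₁ * u₂ * Q * v₁ * v₃ + (2:ℝ) * q * u₁ * u₂ * Q * v₂ * v₃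
          + q * u₁ * u₂ * Q * v₃ * v₃ + (4:ℝ) * q * u₁ * u₂ * Q * v₃ * T + (2:ℝ) * q * u₁ * u₂ * v₁ * v₁ * v₃ + q * u₁ * u₂ * v₁ * v₃ * v₃
          + (4:ℝ) * q * u₁ * u₂ * v₁ * v₃ * T + (2:ℝ) * q * u₁ * u₂ * v₂ * v₂ * v₃ + q * u₁ * u₂ * v₂ * v₃ * v₃ + (4:ℝ) * q * u₁ * u₂ * v₂ * v₃ * T
          + (2:ℝ) * q * u₁ * u₃ * Q * v₁ * v₂ + q * u₁ * u₃ * Q * v₂ * v₂ + (2:ℝ) * q * u₁ * u₃ * Q * v₂ * v₃ + (4:ℝ) * q * u₁ * u₃ * Q * v₂ * T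
          + (2:ℝ) * q * u₁ * u₃ * v₁ * v₁ * v₂ + q * u₁ * u₃ * v₁ * v₂ * v₂ + (4:ℝ) * q * u₁ * u₃ * v₁ * v₂ * T + q * u₁ * u₃ * v₂ * v₂ * v₃
          + (2:ℝ) * q * u₁ * u₃ * v₂ * v₃ * v₃ + (4:ℝ) * q * u₁ * u₃ * v₂ * v₃ * T + (4:ℝ) * q * u₁ * t * Q * v₂ * v₃ + (5:ℝ) * q * u₁ * t * v₁ * v₂ * v₃
          + (2:ℝ) * q * u₁ * t * v₂ * v₂ * v₃ + (2:ℝ) * q * u₁ * t * v₂ * v₃ * v₃ + (4:ℝ) * q * u₁ * t * v₂ * v₃ * T + q * u₂ * u₂ * Q * v₁ * v₃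
          + (2:ℝ) * q * u₂ * u₂ * v₁ * v₁ * v₃ + (2:ℝ) * q * u₂ * u₂ * v₁ * v₂ * v₃ + (2:ℝ) * q * u₂ * u₂ * v₁ * v₃ * v₃ + (2:ℝ) * q * u₂ * u₂ * v₁ * v₃ * T
          + q * u₂ * u₃ * Q * v₁ * v₁ + (2:ℝ) * q * u₂ * u₃ * Q * v₁ * v₂ + (2:ℝ) * q * u₂ * u₃ * Q * v₁ * v₃ + (4:ℝ) * q * u₂ * u₃ * Q * v₁ * T
          + q * u₂ * u₃ * v₁ * v₁ * v₂ + q * u₂ * u₃ * v₁ * v₁ * v₃ + (2:ℝ) * q * u₂ * u₃ * v₁ * v₂ * v₂ + (4:ℝ) * q * u₂ * u₃ * v₁ * v₂ * T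
          + (2:ℝ) * q * u₂ * u₃ * v₁ * v₃ * v₃ + (4:ℝ) * q * u₂ * u₃ * v₁ * v₃ * T + (3:ℝ) * q * u₂ * t * Q * v₁ * v₃ + (4:ℝ) * q * u₂ * t * v₁ * v₁ * v₃
          + (5:ℝ) * q * u₂ * t * v₁ * v₂ * v₃ + (4:ℝ) * q * u₂ * t * v₁ * v₃ * v₃ + (2:ℝ) * q * u₂ * t * v₁ * v₃ * T + q * u₃ * u₃ * Q * v₁ * v₂
          + (2:ℝ) * q * u₃ * u₃ * v₁ * v₁ * v₂ + (2:ℝ) * q * u₃ * u₃ * v₁ * v₂ * v₂ + (2:ℝ) * q * u₃ * u₃ * v₁ * v₂ * v₃ + (2:ℝ) * q * u₃ * u₃ * v₁ * v₂ * T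
          + (5:ℝ) * q * u₃ * t * Q * v₁ * v₂ + (2:ℝ) * q * u₃ * t * v₁ * v₁ * v₂ + (2:ℝ) * q * u₃ * t * v₁ * v₂ * v₂ + (5:ℝ) * q * u₃ * t * v₁ * v₂ * v₃
          + (4:ℝ) * q * u₃ * t * v₁ * v₂ * T + (4:ℝ) * q * t * t * v₁ * v₂ * v₃ + u₁ * u₁ * u₂ * Q * Q * v₃ + (2:ℝ) * u₁ * u₁ * u₂ * Q * v₁ * v₃
          + u₁ * u₁ * u₂ * Q * v₂ * v₃ + (2:ℝ) * u₁ * u₁ * u₂ * Q * v₃ * v₃ + (4:ℝ) * u₁ * u₁ * u₂ * Q * v₃ * T + u₁ * u₁ * u₂ * v₁ * v₁ * v₃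
          + (2:ℝ) * u₁ * u₁ * u₂ * v₁ * v₃ * T + (2:ℝ) * u₁ * u₁ * u₂ * v₂ * v₂ * v₃ + u₁ * u₁ * u₃ * Q * Q * v₂ + (2:ℝ) * u₁ * u₁ * u₃ * Q * v₁ * v₂
          + (2:ℝ) * u₁ * u₁ * u₃ * Q * v₂ * v₂ + u₁ * u₁ * u₃ * Q * v₂ * v₃ + (4:ℝ) * u₁ * u₁ * u₃ * Q * v₂ * T + u₁ * u₁ * u₃ * v₁ * v₁ * v₂
          + (2:ℝ) * u₁ * u₁ * u₃ * v₁ * v₂ * T + (2:ℝ) * u₁ * u₁ * u₃ * v₂ * v₃ * v₃ + u₁ * u₂ * u₂ * Q * Q * v₃ + (2:ℝ) * u₁ * u₂ * u₂ * Q * v₁ * v₃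
          + (2:ℝ) * u₁ * u₂ * u₂ * Q * v₂ * v₃ + (2:ℝ) * u₁ * u₂ * u₂ * Q * v₃ * v₃ + (2:ℝ) * u₁ * u₂ * u₂ * Q * v₃ * T + (2:ℝ) * u₁ * u₂ * u₂ * v₁ * v₂ * v₃
          + (2:ℝ) * u₁ * u₂ * u₂ * v₁ * v₃ * T + u₁ * u₂ * u₂ * v₂ * v₂ * v₃ + (2:ℝ) * u₁ * u₂ * u₂ * v₂ * v₃ * v₃ + (2:ℝ) * u₁ * u₂ * u₂ * v₂ * v₃ * T
          + (2:ℝ) * u₁ * u₂ * u₃ * Q * Q * v₁ + (2:ℝ) * u₁ * u₂ * u₃ * Q * Q * v₂ + (2:ℝ) * u₁ * u₂ * u₃ * Q * Q * v₃ + ((11:ℝ)/2) * u₁ * u₂ * u₃ * Q * Q * T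
          + (2:ℝ) * u₁ * u₂ * u₃ * Q * v₁ * v₁ + ((5:ℝ)/2) * u₁ * u₂ * u₃ * Q * v₁ * v₃ + (5:ℝ) * u₁ * u₂ * u₃ * Q * v₁ * T + (2:ℝ) * u₁ * u₂ * u₃ * Q * v₂ * v₂
          + ((3:ℝ)/2) * u₁ * u₂ * u₃ * Q * v₂ * v₃ + (7:ℝ) * u₁ * u₂ * u₃ * Q * v₂ * T + (2:ℝ) * u₁ * u₂ * u₃ * Q * v₃ * v₃ + (5:ℝ) * u₁ * u₂ * u₃ * Q * v₃ * T
          + (2:ℝ) * u₁ * u₂ * u₃ * Q * T * T + (2:ℝ) * u₁ * u₂ * u₃ * v₁ * v₁ * v₂ + (2:ℝ) * u₁ * u₂ * u₃ * v₁ * v₃ * T + (2:ℝ) * u₁ * u₂ * u₃ * v₂ * v₃ * v₃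
          + (2:ℝ) * u₁ * u₂ * t * Q * Q * v₃ + (4:ℝ) * u₁ * u₂ * t * Q * v₁ * v₃ + (4:ℝ) * u₁ * u₂ * t * Q * v₂ * v₃ + (2:ℝ) * u₁ * u₂ * t * Q * v₃ * v₃
          + (3:ℝ) * u₁ * u₂ * t * Q * v₃ * T + (2:ℝ) * u₁ * u₂ * t * v₁ * v₁ * v₃ + u₁ * u₂ * t * v₁ * v₃ * v₃ + (2:ℝ) * u₁ * u₂ * t * v₁ * v₃ * T
          + (2:ℝ) * u₁ * u₂ * t * v₂ * v₂ * v₃ + u₁ * u₂ * t * v₂ * v₃ * v₃ + (2:ℝ) * u₁ * u₂ * t * v₂ * v₃ * T + u₁ * u₃ * u₃ * Q * Q * v₂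
          + (2:ℝ) * u₁ * u₃ * u₃ * Q * v₂ * v₂ + (2:ℝ) * u₁ * u₃ * u₃ * Q * v₂ * v₃ + (4:ℝ) * u₁ * u₃ * u₃ * Q * v₂ * T + (2:ℝ) * u₁ * u₃ * u₃ * v₁ * v₁ * v₂
          + u₁ * u₃ * u₃ * v₂ * v₃ * v₃ + (2:ℝ) * u₁ * u₃ * u₃ * v₂ * v₃ * T + (2:ℝ) * u₁ * u₃ * t * Q * Q * v₂ + (4:ℝ) * u₁ * u₃ * t * Q * v₁ * v₂
          + (2:ℝ) * u₁ * u₃ * t * Q * v₂ * v₂ + (4:ℝ) * u₁ * u₃ * t * Q * v₂ * v₃ + (3:ℝ) * u₁ * u₃ * t * Q * v₂ * T + (2:ℝ) * u₁ * u₃ * t * v₁ * v₁ * v₂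
          + u₁ * u₃ * t * v₁ * v₂ * v₂ + (2:ℝ) * u₁ * u₃ * t * v₁ * v₂ * T + u₁ * u₃ * t * v₂ * v₂ * v₃ + (2:ℝ) * u₁ * u₃ * t * v₂ * v₃ * v₃
          + (2:ℝ) * u₁ * u₃ * t * v₂ * v₃ * T + u₂ * u₂ * u₃ * Q * Q * v₁ + (2:ℝ) * u₂ * u₂ * u₃ * Q * v₁ * v₁ + (2:ℝ) * u₂ * u₂ * u₃ * Q * v₁ * v₂
          + (2:ℝ) * u₂ * u₂ * u₃ * Q * v₁ * v₃ + (2:ℝ) * u₂ * u₂ * u₃ * Q * v₁ * T + (2:ℝ) * u₂ * u₂ * u₃ * v₁ * v₁ * v₂ + u₂ * u₂ * u₃ * v₁ * v₂ * v₂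
          + (2:ℝ) * u₂ * u₂ * u₃ * v₁ * v₂ * v₃ + (2:ℝ) * u₂ * u₂ * u₃ * v₁ * v₂ * T + (2:ℝ) * u₂ * u₂ * u₃ * v₁ * v₃ * T + u₂ * u₃ * u₃ * Q * Q * v₁
          + (2:ℝ) * u₂ * u₃ * u₃ * Q * v₁ * v₁ + (2:ℝ) * u₂ * u₃ * u₃ * Q * v₁ * v₃ + (4:ℝ) * u₂ * u₃ * u₃ * Q * v₁ * T + (2:ℝ) * u₂ * u₃ * u₃ * v₁ * v₂ * v₂
          + u₂ * u₃ * u₃ * v₁ * v₃ * v₃ + (2:ℝ) * u₂ * u₃ * u₃ * v₁ * v₃ * T + (2:ℝ) * u₂ * u₃ * t * Q * Q * v₁ + (2:ℝ) * u₂ * u₃ * t * Q * v₁ * v₁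
          + (4:ℝ) * u₂ * u₃ * t * Q * v₁ * v₂ + (4:ℝ) * u₂ * u₃ * t * Q * v₁ * v₃ + (3:ℝ) * u₂ * u₃ * t * Q * v₁ * T + u₂ * u₃ * t * v₁ * v₁ * v₂
          + u₂ * u₃ * t * v₁ * v₁ * v₃ + (2:ℝ) * u₂ * u₃ * t * v₁ * v₂ * v₂ + (2:ℝ) * u₂ * u₃ * t * v₁ * v₂ * T + (2:ℝ) * u₂ * u₃ * t * v₁ * v₃ * v₃
          + (2:ℝ) * u₂ * u₃ * t * v₁ * v₃ * T)
      + (q * Q * Q * T + ((1:ℝ)/2) * q * Q * v₁ * v₂ + q * v₁ * v₁ * v₂ + q * v₁ * v₁ * v₃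
          + q * v₁ * v₂ * v₂ + (2:ℝ) * q * v₁ * v₂ * T + q * v₁ * v₃ * v₃ + (2:ℝ) * q * v₁ * v₃ * T
          + q * v₂ * v₂ * v₃ + q * v₂ * v₃ * v₃ + (2:ℝ) * q * v₂ * v₃ * T + u₁ * Q * Q * v₂
          + u₁ * Q * Q * v₃ + u₁ * Q * Q * T + ((3:ℝ)/2) * u₁ * Q * v₁ * v₂ + u₁ * Q * v₁ * v₃
          + u₁ * Q * v₁ * T + u₁ * Q * v₂ * v₂ + (2:ℝ) * u₁ * Q * v₂ * T + u₁ * Q * v₃ * v₃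
          + (2:ℝ) * u₁ * Q * v₃ * T + u₁ * v₁ * v₂ * v₃ + (2:ℝ) * u₁ * v₁ * v₂ * T + (2:ℝ) * u₁ * v₁ * v₃ * T
          + u₂ * Q * Q * v₁ + u₂ * Q * Q * v₃ + (2:ℝ) * u₂ * Q * Q * T + u₂ * Q * v₁ * v₁
          + ((1:ℝ)/2) * u₂ * Q * v₁ * v₂ + u₂ * Q * v₂ * T + u₂ * Q * v₃ * v₃ + (2:ℝ) * u₂ * Q * T * T
          + (2:ℝ) * u₂ * v₁ * v₁ * v₂ + (4:ℝ) * u₂ * v₁ * v₂ * v₃ + (2:ℝ) * u₂ * v₂ * v₃ * v₃ + u₃ * Q * Q * v₁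
          + u₃ * Q * Q * v₂ + ((1:ℝ)/2) * u₃ * Q * Q * T + u₃ * Q * v₁ * v₁ + ((3:ℝ)/2) * u₃ * Q * v₁ * v₃
          + (2:ℝ) * u₃ * Q * v₁ * T + u₃ * Q * v₂ * v₂ + ((3:ℝ)/2) * u₃ * Q * v₂ * v₃ + (2:ℝ) * u₃ * Q * v₂ * T
          + (2:ℝ) * u₃ * v₁ * v₂ * v₃ + u₃ * v₁ * v₃ * v₃ + (2:ℝ) * u₃ * v₁ * v₃ * T + u₃ * v₂ * v₃ * v₃
          + (2:ℝ) * u₃ * v₂ * v₃ * T + t * Q * v₁ * v₂ + (2:ℝ) * t * Q * T * T) * ((AG q u₁ u₂ u₃ t))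
      + (u₂ * v₁ + u₂ * v₃) * ((AG q u₁ u₂ u₃ t) * (AG Q v₁ v₂ v₃ T))
      + (q * q * u₁ * v₂ + q * q * u₁ * v₃ + q * q * u₂ * v₁ + q * q * u₂ * v₃
          + q * q * u₃ * v₁ + q * q * u₃ * v₂ + q * q * t * v₁ + q * q * t * v₂
          + q * q * t * v₃ + q * u₁ * u₁ * v₂ + q * u₁ * u₁ * v₃ + q * u₁ * u₂ * Q
          + q * u₁ * u₂ * v₁ + q * u₁ * u₂ * v₂ + q * u₁ * u₃ * Q + q * u₁ * u₃ * v₁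
          + q * u₁ * u₃ * v₃ + q * u₂ * u₂ * v₁ + q * u₂ * u₂ * v₃ + q * u₂ * u₃ * Q
          + q * u₂ * u₃ * v₂ + q * u₂ * u₃ * v₃ + (2:ℝ) * q * u₂ * t * v₁ + q * u₂ * t * v₂
          + (2:ℝ) * q * u₂ * t * v₃ + q * u₃ * u₃ * v₁ + q * u₃ * u₃ * v₂ + ((1:ℝ)/2) * q * u₃ * t * Q
          + q * u₃ * t * v₃ + u₁ * u₁ * u₂ * Q + u₁ * u₁ * u₂ * v₁ + (2:ℝ) * u₁ * u₁ * u₂ * v₂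
          + u₁ * u₁ * u₃ * Q + u₁ * u₁ * u₃ * v₁ + (2:ℝ) * u₁ * u₁ * u₃ * v₃ + u₁ * u₂ * u₂ * Q
          + (3:ℝ) * u₁ * u₂ * u₃ * v₁ + (2:ℝ) * u₁ * u₂ * u₃ * v₂ + (2:ℝ) * u₁ * u₂ * u₃ * v₃ + u₁ * u₂ * t * Q
          + u₁ * u₂ * t * v₁ + u₁ * u₂ * t * v₂ + ((1:ℝ)/2) * u₁ * u₃ * u₃ * Q + (2:ℝ) * u₁ * u₃ * u₃ * v₁
          + u₁ * u₃ * t * Q + u₁ * u₃ * t * v₁ + u₁ * u₃ * t * v₃ + u₂ * u₂ * u₃ * Q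
          + ((1:ℝ)/2) * u₂ * u₃ * u₃ * Q + (2:ℝ) * u₂ * u₃ * u₃ * v₂ + u₂ * u₃ * t * Q + u₂ * u₃ * t * v₂
          + u₂ * u₃ * t * v₃) * ((AG Q v₁ v₂ v₃ T))
      + ((2:ℝ) * v₁) * ((AG Q v₁ v₂ v₃ T) * (CubicThreePointStep.F q u₁ u₂ u₃ t))
      + (Q * Q * Q + (2:ℝ) * Q * Q * v₁ + (2:ℝ) * Q * Q * v₂ + (2:ℝ) * Q * Q * v₃
          + (2:ℝ) * Q * Q * T + Q * v₁ * v₁ + ((3:ℝ)/2) * Q * v₁ * v₂ + (2:ℝ) * Q * v₁ * v₃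
          + Q * v₂ * v₂ + (2:ℝ) * Q * v₂ * v₃ + (2:ℝ) * Q * v₂ * T + Q * v₃ * v₃
          + (2:ℝ) * Q * v₃ * T + (2:ℝ) * v₁ * v₁ * v₂ + (2:ℝ) * v₁ * v₁ * v₃) * ((CubicThreePointStep.F q u₁ u₂ u₃ t))
      + (q * q * q + (2:ℝ) * q * q * u₁ + (2:ℝ) * q * q * u₂ + (2:ℝ) * q * q * u₃
          + (2:ℝ) * q * q * t + q * u₁ * u₁ + (2:ℝ) * q * u₁ * u₂ + (2:ℝ) * q * u₁ * u₃
          + (2:ℝ) * q * u₁ * t + q * u₂ * u₂ + (2:ℝ) * q * u₂ * u₃ + q * u₂ * t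
          + q * u₃ * u₃ + (2:ℝ) * q * u₃ * t + u₁ * u₂ * u₂ + u₁ * u₂ * t
          + u₁ * u₃ * t + u₂ * u₂ * u₃ + u₂ * u₃ * t) * ((CubicThreePointStep.F Q v₁ v₂ v₃ T)) := by
    simp only [CubicThreePointStep.F, AG]; ring
  rw [key]
  generalize CubicThreePointStep.F q u₁ u₂ u₃ t = RX at hfx ⊢
  generalize CubicThreePointStep.F Q v₁ v₂ v₃ T = RY at hfy ⊢
  generalize AG q u₁ u₂ u₃ t = AX at hagx ⊢
  generalize AG Q v₁ v₂ v₃ T = AY at hagy ⊢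
  positivity

/-- `q ↔ t` duality exchanges the twin rows: `F(t,u,q) = T_inc(q,u,t)` (homogeneous forms). [folklore] -/
theorem F_dual_eq_tincH (q u₁ u₂ u₃ t : ℝ) :
    CubicThreePointStep.F t u₁ u₂ u₃ q = Xi q u₁ u₂ u₃ t + q * AG q u₁ u₂ u₃ t := by
  simp only [CubicThreePointStep.F, Xi, AG]; ring

/-- **`{AG ≥ 0, T_inc ≥ 0}` is closed under the MEET composition** (`zt = tT`, `zᵢ = t vᵢ + uᵢ T + uᵢ vᵢ`, `zq` = the rest; pendant gluings are meets with arm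
laws) — the `q ↔ t` dual of `F_join_nonneg`. [cite: Gladkov2024StrongFKG, Cor. 4.2 (AG)] -/
theorem tincH_meet_nonneg {q u₁ u₂ u₃ t Q v₁ v₂ v₃ T zq z₁ z₂ z₃ zt : ℝ}
    (hq : 0 ≤ q) (hu₁ : 0 ≤ u₁) (hu₂ : 0 ≤ u₂) (hu₃ : 0 ≤ u₃) (ht : 0 ≤ t)
    (hQ : 0 ≤ Q) (hv₁ : 0 ≤ v₁) (hv₂ : 0 ≤ v₂) (hv₃ : 0 ≤ v₃) (hT : 0 ≤ T)
    (hagx : 0 ≤ AG q u₁ u₂ u₃ t) (hagy : 0 ≤ AG Q v₁ v₂ v₃ T)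
    (htx : 0 ≤ Xi q u₁ u₂ u₃ t + q * AG q u₁ u₂ u₃ t) (hty : 0 ≤ Xi Q v₁ v₂ v₃ T + Q * AG Q v₁ v₂ v₃ T)
    (hzt : zt = t * T) (hz₁ : z₁ = t * v₁ + u₁ * T + u₁ * v₁) (hz₂ : z₂ = t * v₂ + u₂ * T + u₂ * v₂)
    (hz₃ : z₃ = t * v₃ + u₃ * T + u₃ * v₃)
    (hzq : zq = q * (T + v₁ + v₂ + v₃ + Q) + Q * (t + u₁ + u₂ + u₃) + (u₁ * (v₂ + v₃) + u₂ * (v₁ + v₃) + u₃ * (v₁ + v₂))) :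
    0 ≤ Xi zq z₁ z₂ z₃ zt + zq * AG zq z₁ z₂ z₃ zt := by
  have hagx' : 0 ≤ AG t u₁ u₂ u₃ q := by rw [AG_dual]; exact hagx
  have hagy' : 0 ≤ AG T v₁ v₂ v₃ Q := by rw [AG_dual]; exact hagy
  have hfx : 0 ≤ CubicThreePointStep.F t u₁ u₂ u₃ q := by rw [F_dual_eq_tincH]; exact htx
  have hfy : 0 ≤ CubicThreePointStep.F T v₁ v₂ v₃ Q := by rw [F_dual_eq_tincH]; exact hty
  have h := F_join_nonneg ht hu₁ hu₂ hu₃ hq hT hv₁ hv₂ hv₃ hQ hagx' hagy' hfx hfy rfl rfl rfl rfl rfl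
  rw [← F_dual_eq_tincH]
  subst hzt hz₁ hz₂ hz₃ hzq
  exact h

/-- **`{AG ≥ 0, F ≥ 0}` is closed under the MEET composition** — the `q ↔ t` dual of `tincH_join_nonneg`. [cite: Gladkov2024StrongFKG, Cor. 4.2 (AG)] -/
theorem F_meet_nonneg {q u₁ u₂ u₃ t Q v₁ v₂ v₃ T zq z₁ z₂ z₃ zt : ℝ}
    (hq : 0 ≤ q) (hu₁ : 0 ≤ u₁) (hu₂ : 0 ≤ u₂) (hu₃ : 0 ≤ u₃) (ht : 0 ≤ t)
    (hQ : 0 ≤ Q) (hv₁ : 0 ≤ v₁) (hv₂ : 0 ≤ v₂) (hv₃ : 0 ≤ v₃) (hT : 0 ≤ T)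
    (hagx : 0 ≤ AG q u₁ u₂ u₃ t) (hagy : 0 ≤ AG Q v₁ v₂ v₃ T)
    (hfx : 0 ≤ CubicThreePointStep.F q u₁ u₂ u₃ t) (hfy : 0 ≤ CubicThreePointStep.F Q v₁ v₂ v₃ T)
    (hzt : zt = t * T) (hz₁ : z₁ = t * v₁ + u₁ * T + u₁ * v₁) (hz₂ : z₂ = t * v₂ + u₂ * T + u₂ * v₂)
    (hz₃ : z₃ = t * v₃ + u₃ * T + u₃ * v₃)
    (hzq : zq = q * (T + v₁ + v₂ + v₃ + Q) + Q * (t + u₁ + u₂ + u₃) + (u₁ * (v₂ + v₃) + u₂ * (v₁ + v₃) + u₃ * (v₁ + v₂))) :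
    0 ≤ CubicThreePointStep.F zq z₁ z₂ z₃ zt := by
  have hagx' : 0 ≤ AG t u₁ u₂ u₃ q := by rw [AG_dual]; exact hagx
  have hagy' : 0 ≤ AG T v₁ v₂ v₃ Q := by rw [AG_dual]; exact hagy
  have htx : 0 ≤ Xi t u₁ u₂ u₃ q + t * AG t u₁ u₂ u₃ q := by rw [← F_dual_eq_tincH]; exact hfx
  have hty : 0 ≤ Xi T v₁ v₂ v₃ Q + T * AG T v₁ v₂ v₃ Q := by rw [← F_dual_eq_tincH]; exact hfy
  have h := tincH_join_nonneg ht hu₁ hu₂ hu₃ hq hT hv₁ hv₂ hv₃ hQ hagx' hagy' htx hty rfl rfl rfl rfl rfl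
  subst hzt hz₁ hz₂ hz₃ hzq
  rw [F_dual_eq_tincH]
  exact h

end IncTwin

/-! ## Graph level: `T_inc ≥ 0` is preserved by gluing two edge systems along the terminal triple -/

namespace TerminalGluing

open Finset Literature.Probability.Percolation Literature.Probability.Percolation.DecisionTree
open CubicThreePointTerminal CubicThreePointStep CubicThreePointJoin

variable {V : Type*} [DecidableEq V]

/-- **Terminal gluing preserves the increasing twin row.**  Two systems `(D₁,K₁)`, `(D₂,K₂)` on disjoint random edge sets whose edges meet only in the
terminals `a, b, c`; if both finitary laws satisfy `T_inc = Ξ + q·AG ≥ 0` then so does the law of the glued system `(D₁ ∪ D₂, K₁ ∪ K₂)`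
(Gladkov's `AG ≥ 0` holds for every `PrW` law, `AG_PrW_nonneg`). [cite: Gladkov2024StrongFKG, Cor. 4.2 (AG)] -/
theorem tincW_join_nonneg {D₁ D₂ K₁ K₂ : Finset (Sym2 V)} {p : Sym2 V → ℝ} {a b c : V} (hp0 : ∀ i, 0 ≤ p i) (hp1 : ∀ i, p i ≤ 1)
    (hD : Disjoint D₁ D₂) (hsep : ∀ v : V, ∀ e₁ ∈ D₁ ∪ K₁, ∀ e₂ ∈ D₂ ∪ K₂, v ∈ e₁ → v ∈ e₂ → (v = a ∨ v = b ∨ v = c))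
    (h₁ : 0 ≤ Xi (PrW D₁ p (evQ K₁ a b c)) (PrW D₁ p (evU₁ K₁ a b c)) (PrW D₁ p (evU₂ K₁ a b c)) (PrW D₁ p (evU₃ K₁ a b c)) (PrW D₁ p (evT K₁ a b c))
      + PrW D₁ p (evQ K₁ a b c) *
        AG (PrW D₁ p (evQ K₁ a b c)) (PrW D₁ p (evU₁ K₁ a b c)) (PrW D₁ p (evU₂ K₁ a b c)) (PrW D₁ p (evU₃ K₁ a b c)) (PrW D₁ p (evT K₁ a b c)))
    (h₂ : 0 ≤ Xi (PrW D₂ p (evQ K₂ a b c)) (PrW D₂ p (evU₁ K₂ a b c)) (PrW D₂ p (evU₂ K₂ a b c)) (PrW D₂ p (evU₃ K₂ a b c)) (PrW D₂ p (evT K₂ a b c))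
      + PrW D₂ p (evQ K₂ a b c) *
        AG (PrW D₂ p (evQ K₂ a b c)) (PrW D₂ p (evU₁ K₂ a b c)) (PrW D₂ p (evU₂ K₂ a b c)) (PrW D₂ p (evU₃ K₂ a b c)) (PrW D₂ p (evT K₂ a b c))) :
    0 ≤ Xi (PrW (D₁ ∪ D₂) p (evQ (K₁ ∪ K₂) a b c)) (PrW (D₁ ∪ D₂) p (evU₁ (K₁ ∪ K₂) a b c)) (PrW (D₁ ∪ D₂) p (evU₂ (K₁ ∪ K₂) a b c))
        (PrW (D₁ ∪ D₂) p (evU₃ (K₁ ∪ K₂) a b c)) (PrW (D₁ ∪ D₂) p (evT (K₁ ∪ K₂) a b c))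
      + PrW (D₁ ∪ D₂) p (evQ (K₁ ∪ K₂) a b c) *
        AG (PrW (D₁ ∪ D₂) p (evQ (K₁ ∪ K₂) a b c)) (PrW (D₁ ∪ D₂) p (evU₁ (K₁ ∪ K₂) a b c)) (PrW (D₁ ∪ D₂) p (evU₂ (K₁ ∪ K₂) a b c))
          (PrW (D₁ ∪ D₂) p (evU₃ (K₁ ∪ K₂) a b c)) (PrW (D₁ ∪ D₂) p (evT (K₁ ∪ K₂) a b c)) := by
  have hσ₁ := PrW_cells_sum_one D₁ p K₁ a b c
  have hσ₂ := PrW_cells_sum_one D₂ p K₂ a b c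
  have hzt : PrW (D₁ ∪ D₂) p (evT (K₁ ∪ K₂) a b c) =
      PrW D₁ p (evT K₁ a b c) * (PrW D₂ p (evQ K₂ a b c) + PrW D₂ p (evU₁ K₂ a b c) + PrW D₂ p (evU₂ K₂ a b c) + PrW D₂ p (evU₃ K₂ a b c)
          + PrW D₂ p (evT K₂ a b c)) +
        PrW D₂ p (evT K₂ a b c) * (PrW D₁ p (evQ K₁ a b c) + PrW D₁ p (evU₁ K₁ a b c) + PrW D₁ p (evU₂ K₁ a b c) + PrW D₁ p (evU₃ K₁ a b c)) +
        (PrW D₁ p (evU₁ K₁ a b c) * (PrW D₂ p (evU₂ K₂ a b c) + PrW D₂ p (evU₃ K₂ a b c)) +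
          PrW D₁ p (evU₂ K₁ a b c) * (PrW D₂ p (evU₁ K₂ a b c) + PrW D₂ p (evU₃ K₂ a b c)) +
          PrW D₁ p (evU₃ K₁ a b c) * (PrW D₂ p (evU₁ K₂ a b c) + PrW D₂ p (evU₂ K₂ a b c))) := by
    rw [PrW_join_T p hD hsep]
    linear_combination (-(PrW D₁ p (evT K₁ a b c))) * hσ₂ + (-(PrW D₂ p (evT K₂ a b c))) * hσ₁
  exact IncTwin.tincH_join_nonneg (PrW_nonneg D₁ hp0 hp1 _) (PrW_nonneg D₁ hp0 hp1 _) (PrW_nonneg D₁ hp0 hp1 _) (PrW_nonneg D₁ hp0 hp1 _)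
    (PrW_nonneg D₁ hp0 hp1 _) (PrW_nonneg D₂ hp0 hp1 _) (PrW_nonneg D₂ hp0 hp1 _) (PrW_nonneg D₂ hp0 hp1 _) (PrW_nonneg D₂ hp0 hp1 _)
    (PrW_nonneg D₂ hp0 hp1 _) (AG_PrW_nonneg a b c hp0 hp1 D₁ K₁) (AG_PrW_nonneg a b c hp0 hp1 D₂ K₂) h₁ h₂
    (PrW_join_Q p hD hsep) (PrW_join_U₁ p hD hsep) (PrW_join_U₂ p hD hsep) (PrW_join_U₃ p hD hsep) hzt

end TerminalGluing

end Summit.CriticalPhenomena.PercolationContinuityZ3.Theorems
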